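import Literature.NumberTheory.Automorphic.StrongApproximationGL2
import Literature.AlgebraicGeometry.ModuliOfAbelianVarieties.SiegelPrincipalLevelOpen
import Literature.AlgebraicGeometry.ModuliOfAbelianVarieties.SiegelTransporterBounds
import HarnessLib

/-!
# Congruence classes of finite idèles of `ℚ`: `ℚ_{>0}^× \ 𝔸_{ℚ,f}^× / (ẑ^× ∩ (1 + Nẑ)) ≅ (ℤ/Nℤ)^×`

Topic `NumberTheory/Adeles`; namespace `Literature.NumberTheory.Adeles`.  THEOREMS ONLY (no definition, no named
fact, no instance, no `sorry`).  Cell hodgecm-mathlib, road #60 (`SiegelS1`), the idèle input of the PIECE INDEX of the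
Siegel modular variety ([Milne2005ShimuraVarieties] Lemma 5.13 / (5.2) and Thm. 5.17 for `G = GSp_δ`, `T = 𝔾_m`,
`ν(K_δ(N)) = ẑ^× ∩ (1+Nẑ)`): the set `ℚ_{>0}^× \ 𝔸_{ℚ,f}^× / U_N`, `U_N := {u ∈ ẑ^× | u ≡ 1 (mod N ẑ)}`, is in
canonical bijection with `(ℤ/Nℤ)^×`.  Stated WITHOUT a quotient type, over the tree's currency `finAdeleQ = 𝔸_{ℚ,f}`,
`levelIdeal N = N·ẑ ⊆ 𝔸_{ℚ,f}` (★ `ModuliOfAbelianVarieties.SiegelComplexRecordSystem`) and «`u` is a `ẑ`-unit» =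
«`|u_v|_v = 1` for every finite place `v`»:

* §1 valuation criteria: `x ∈ ẑ ↔ ∀ v, |x_v|_v ≤ 1`; `x ∈ N·ẑ ↔ ∀ v, |x_v|_v ≤ |N|_v`; `ℤ ∩ N·ẑ = Nℤ`.
* §2 UNIQUENESS of the decomposition `𝔸_{ℚ,f}^× = ℚ_{>0}^× · ẑ^×` whose EXISTENCE is ★
  `Automorphic.Rat.FiniteAdeleRing.exists_pos_valued_algebraMap_mul_eq_one`: a positive rational with `|r|_v = 1` for
  all `v` is `1` (`ℚ_{>0} ∩ ẑ^× = {1}`), so the normalising scalar `r` of an idèle is unique.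
* §3 RESIDUES: every `ẑ`-integral adele is `≡ a (mod N ẑ)` for an integer `a` (`𝔸_{ℚ,f} = ℚ + N ẑ`, ★
  `exists_rat_add_natCast_mul`, and `ℚ ∩ ẑ = ℤ`), two residues of one element differ by a multiple of `N`, and the
  residue of a `ẑ`-UNIT is prime to `N`.
* §4 SURJECTIVITY `ẑ^× ↠ (ℤ/Nℤ)^×`: every integer prime to `N` is the residue of a `ẑ`-unit (the idèle which is `a`
  at the primes dividing `N` and `1` elsewhere).
* §5 THE CLASS CRITERION: normalise `x ∈ 𝔸_{ℚ,f}^×` by its positive rational `r_x` (§2) and reduce `r_x·x ∈ ẑ^×`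
  modulo `N` (§3) to a residue `a_x` prime to `N`; then `x' ∈ ℚ_{>0}·x·U_N ↔ a_{x'} ≡ a_x (mod N)`, and by §4 every
  class prime to `N` occurs — i.e. `x ↦ a_x` is a bijection `ℚ_{>0}^×\𝔸_{ℚ,f}^×/U_N → (ℤ/Nℤ)^×`.

## References
* [Milne2005ShimuraVarieties] J. S. Milne, *Introduction to Shimura varieties* (2005; 2017 revision, same numbering), §4 Rem. 4.17 (a)
  with fn. 31 p. 48 (`ℚ_{>0} ∩ ẑ^× = {1}`: «such an `a` is an `ℓ`-adic unit for all `ℓ`, and so equals `±1`»), §5: (5.2), Lemma 5.13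
  p. 57, Thm. 5.17 p. 59, and §5 p. 63 (the paragraph after Rem. 5.23: for `(GL₂, ℋ^±)`, `K = K(N)`,
  `π₀ = ℚ^×∖{±1} × 𝔸_f^×/(1+Nẑ)^× ≃ (ℤ/Nℤ)^×`, i.e. `𝔸_f^× = ℚ_{>0}^×·ẑ^×`, class number one).
* [CasselsFrohlichANT1967] J. W. S. Cassels, A. Fröhlich (eds.), *Algebraic Number Theory* (1967), Ch. II §§14–16
  (restricted products, idèles, `ℚ ∩ ẑ = ℤ`).
* [Gelbart1975] S. Gelbart, *Automorphic forms on adele groups* (1975), (3.3).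
-/

noncomputable section

open IsDedekindDomain IsDedekindDomain.HeightOneSpectrum NumberField
open Literature.AlgebraicGeometry.ModuliOfAbelianVarieties (finAdeleQ levelIdeal mem_levelIdeal_iff
  mem_levelIdeal_iff_inv_mul_mem isUnit_natCast_finAdeleQ mem_integralAdeles_of_mem_levelIdeal levelIdeal_anti
  valued_algebraMap_finAdeleQ_apply exists_int_cast_eq_of_algebraMap_mem_integralAdeles)

namespace Literature.NumberTheory.Adeles

/-! ### §1. Valuation criteria for `ẑ` and `N·ẑ`; `ℤ ∩ N·ẑ = Nℤ` -/

/-- `x ∈ ẑ = 𝓞̂` iff `|x_v|_v ≤ 1` at every finite place. [cite: CasselsFrohlichANT1967, Ch. II §14] -/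
theorem mem_integralAdeles_iff_forall_valued_le_one (x : finAdeleQ) :
    x ∈ FiniteAdeleRing.integralAdeles (𝓞 ℚ) ℚ ↔ ∀ v, Valued.v (x v) ≤ 1 := by
  constructor
  · rintro ⟨y, rfl⟩ v
    exact (HeightOneSpectrum.mem_adicCompletionIntegers _ _ _).1 (y v).2
  · intro h
    exact ⟨fun v => ⟨x v, (HeightOneSpectrum.mem_adicCompletionIntegers _ _ _).2 (h v)⟩,
      FiniteAdeleRing.ext ℚ (fun v => rfl)⟩

/-- The tree's two spellings of `ẑ` agree: FLT's `FiniteAdeleRing.integralAdeles` (range of the structure map) and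
`Automorphic.integralFiniteAdeles ℚ` (integral at every place). [cite: CasselsFrohlichANT1967, Ch. II §14] -/
theorem mem_integralAdeles_iff_mem_integralFiniteAdeles (x : finAdeleQ) :
    x ∈ FiniteAdeleRing.integralAdeles (𝓞 ℚ) ℚ ↔ x ∈ Literature.NumberTheory.Automorphic.integralFiniteAdeles ℚ := by
  rw [mem_integralAdeles_iff_forall_valued_le_one, Literature.NumberTheory.Automorphic.mem_integralFiniteAdeles_iff]
  exact forall_congr' fun v => (HeightOneSpectrum.mem_adicCompletionIntegers _ _ _).symm

/-- A `ẑ`-unit (all valuations `1`) is `ẑ`-integral. [cite: CasselsFrohlichANT1967, Ch. II §16] -/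
theorem mem_integralAdeles_of_forall_valued_eq_one {x : finAdeleQ} (hx : ∀ v, Valued.v (x v) = 1) :
    x ∈ FiniteAdeleRing.integralAdeles (𝓞 ℚ) ℚ :=
  (mem_integralAdeles_iff_forall_valued_le_one x).2 fun v => (hx v).le

/-- `|N|_v = v(N)`, the `v`-adic valuation of the natural number `N`. [cite: CasselsFrohlichANT1967, Ch. II §14] -/
theorem valued_natCast_finAdeleQ_apply (N : ℕ) (v : HeightOneSpectrum (𝓞 ℚ)) :
    Valued.v ((N : finAdeleQ) v) = v.valuation ℚ (N : ℚ) := by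
  rw [← map_natCast (algebraMap ℚ finAdeleQ) N, valued_algebraMap_finAdeleQ_apply]

/-- `|N|_v ≠ 0` for `N ≠ 0`. [cite: CasselsFrohlichANT1967, Ch. II §14] -/
theorem valued_natCast_finAdeleQ_ne_zero {N : ℕ} (hN : N ≠ 0) (v : HeightOneSpectrum (𝓞 ℚ)) :
    Valued.v ((N : finAdeleQ) v) ≠ 0 := by
  rw [valued_natCast_finAdeleQ_apply, Valuation.ne_zero_iff]
  exact_mod_cast hN

/-- `|N|_v ≤ 1`. [cite: CasselsFrohlichANT1967, Ch. II §14] -/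
theorem valued_natCast_finAdeleQ_le_one (N : ℕ) (v : HeightOneSpectrum (𝓞 ℚ)) :
    Valued.v ((N : finAdeleQ) v) ≤ 1 := by
  rw [valued_natCast_finAdeleQ_apply, ← map_natCast (algebraMap (𝓞 ℚ) ℚ) N]
  exact valuation_le_one v _

/-- **`x ∈ N·ẑ ↔ |x_v|_v ≤ |N|_v` for every `v`** (`N ≠ 0`). [cite: CasselsFrohlichANT1967, Ch. II §14] -/
theorem mem_levelIdeal_iff_forall_valued_le {N : ℕ} (hN : N ≠ 0) (x : finAdeleQ) :
    x ∈ levelIdeal N ↔ ∀ v, Valued.v (x v) ≤ Valued.v ((N : finAdeleQ) v) := by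
  rw [mem_levelIdeal_iff_inv_mul_mem hN, mem_integralAdeles_iff_forall_valued_le_one]
  set u : finAdeleQˣ := (isUnit_natCast_finAdeleQ hN).unit with hu
  have huN : (u : finAdeleQ) = N := rfl
  refine forall_congr' fun v => ?_
  have huv : Valued.v (((u⁻¹ : finAdeleQˣ) : finAdeleQ) v) * Valued.v ((u : finAdeleQ) v) = 1 := by
    rw [← Valuation.map_mul, ← Literature.NumberTheory.Automorphic.FiniteAdeleRing.mul_apply', Units.inv_mul,
      show (1 : finAdeleQ) v = 1 from rfl, Valuation.map_one]
  rw [Literature.NumberTheory.Automorphic.FiniteAdeleRing.mul_apply', Valuation.map_mul, ← huN]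
  constructor
  · intro h
    calc Valued.v (x v) = Valued.v ((u : finAdeleQ) v) * Valued.v (((u⁻¹ : finAdeleQˣ) : finAdeleQ) v) *
          Valued.v (x v) := by rw [mul_comm (Valued.v ((u : finAdeleQ) v)), huv, one_mul]
      _ = Valued.v ((u : finAdeleQ) v) * (Valued.v (((u⁻¹ : finAdeleQˣ) : finAdeleQ) v) * Valued.v (x v)) :=
          mul_assoc _ _ _
      _ ≤ Valued.v ((u : finAdeleQ) v) * 1 := mul_le_mul' le_rfl h
      _ = Valued.v ((u : finAdeleQ) v) := mul_one _
  · intro h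
    calc Valued.v (((u⁻¹ : finAdeleQˣ) : finAdeleQ) v) * Valued.v (x v)
        ≤ Valued.v (((u⁻¹ : finAdeleQˣ) : finAdeleQ) v) * Valued.v ((u : finAdeleQ) v) := mul_le_mul' le_rfl h
      _ = 1 := huv

/-- `|a|_v = v(a)` for an integer `a`. [cite: CasselsFrohlichANT1967, Ch. II §14] -/
theorem valued_intCast_finAdeleQ_apply (a : ℤ) (v : HeightOneSpectrum (𝓞 ℚ)) :
    Valued.v ((a : finAdeleQ) v) = v.valuation ℚ (a : ℚ) := by
  rw [← map_intCast (algebraMap ℚ finAdeleQ) a, valued_algebraMap_finAdeleQ_apply]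

/-- `|a|_v ≤ 1` for an integer `a`. [cite: CasselsFrohlichANT1967, Ch. II §14] -/
theorem valued_intCast_finAdeleQ_le_one (a : ℤ) (v : HeightOneSpectrum (𝓞 ℚ)) :
    Valued.v ((a : finAdeleQ) v) ≤ 1 := by
  rw [valued_intCast_finAdeleQ_apply, ← map_intCast (algebraMap (𝓞 ℚ) ℚ) a]
  exact valuation_le_one v _

/-- Integers are `ẑ`-integral. [cite: CasselsFrohlichANT1967, Ch. II §14] -/
theorem intCast_mem_integralAdeles (a : ℤ) : (a : finAdeleQ) ∈ FiniteAdeleRing.integralAdeles (𝓞 ℚ) ℚ :=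
  (mem_integralAdeles_iff_forall_valued_le_one _).2 (valued_intCast_finAdeleQ_le_one a)

/-- **`ℤ ∩ N·ẑ = Nℤ`**: an integer lies in `N·ẑ` iff `N` divides it (`N ≠ 0`).
[cite: CasselsFrohlichANT1967, Ch. II §15] -/
theorem intCast_mem_levelIdeal_iff {N : ℕ} (hN : N ≠ 0) (a : ℤ) :
    (a : finAdeleQ) ∈ levelIdeal N ↔ (N : ℤ) ∣ a := by
  constructor
  · intro h
    have h' := (mem_levelIdeal_iff_inv_mul_mem hN _).1 h
    have hNQ : (N : ℚ) ≠ 0 := Nat.cast_ne_zero.2 hN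
    have hinv : (((isUnit_natCast_finAdeleQ hN).unit⁻¹ : finAdeleQˣ) : finAdeleQ) =
        algebraMap ℚ finAdeleQ (N : ℚ)⁻¹ :=
      Units.inv_eq_of_mul_eq_one_right (by
        rw [IsUnit.unit_spec, ← map_natCast (algebraMap ℚ finAdeleQ) N, ← map_mul, mul_inv_cancel₀ hNQ, map_one])
    have heq : (((isUnit_natCast_finAdeleQ hN).unit⁻¹ : finAdeleQˣ) : finAdeleQ) * (a : finAdeleQ) =
        algebraMap ℚ finAdeleQ ((N : ℚ)⁻¹ * a) := by
      rw [hinv, map_mul, map_intCast]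
    rw [heq] at h'
    obtain ⟨z, hz⟩ := exists_int_cast_eq_of_algebraMap_mem_integralAdeles h'
    refine ⟨z, ?_⟩
    have : (a : ℚ) = N * z := by rw [hz, ← mul_assoc, mul_inv_cancel₀ hNQ, one_mul]
    exact_mod_cast this
  · rintro ⟨b, rfl⟩
    refine mem_levelIdeal_iff.2 ⟨(b : finAdeleQ), intCast_mem_integralAdeles b, ?_⟩
    push_cast
    rfl

/-! ### §2. `ℚ_{>0} ∩ ẑ^× = {1}`: uniqueness of the decomposition `𝔸_{ℚ,f}^× = ℚ_{>0}^× · ẑ^×` -/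

/-- **`ℚ_{>0} ∩ ẑ^× = {1}`**: a POSITIVE rational number with `v(r) = 1` at every finite place is `1` (it and its
inverse are integers: `ℤˣ ∩ ℚ_{>0} = {1}`). [cite: Milne2005ShimuraVarieties, §4 Rem. 4.17 (a) with fn. 31 p. 48]
[cite: CasselsFrohlichANT1967, Ch. II §16] -/
theorem Rat.eq_one_of_pos_of_forall_valuation_eq_one {r : ℚ} (hr : 0 < r)
    (h : ∀ v : HeightOneSpectrum (𝓞 ℚ), v.valuation ℚ r = 1) : r = 1 := by
  -- `r` and `r⁻¹` are integers (Mathlib `mem_integers_of_valuation_le_one`, `𝓞 ℚ = ℤ`)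
  obtain ⟨z, hz⟩ : ∃ z : ℤ, (z : ℚ) = r := by
    obtain ⟨x, hx⟩ := HeightOneSpectrum.mem_integers_of_valuation_le_one ℚ r fun v => (h v).le
    exact ⟨Rat.ringOfIntegersEquiv x, by rw [Rat.ringOfIntegersEquiv_apply_coe]; exact hx⟩
  obtain ⟨z', hz'⟩ : ∃ z' : ℤ, (z' : ℚ) = r⁻¹ := by
    obtain ⟨x, hx⟩ := HeightOneSpectrum.mem_integers_of_valuation_le_one ℚ r⁻¹ fun v => by
      rw [map_inv₀, h v, inv_one]
    exact ⟨Rat.ringOfIntegersEquiv x, by rw [Rat.ringOfIntegersEquiv_apply_coe]; exact hx⟩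
  have hzz' : z * z' = 1 := by
    have h1 : (z : ℚ) * z' = 1 := by rw [hz, hz', mul_inv_cancel₀ hr.ne']
    exact_mod_cast h1
  have hz0 : 0 ≤ z := by
    have : (0 : ℚ) ≤ z := by rw [hz]; exact hr.le
    exact_mod_cast this
  rw [← hz, Int.eq_one_of_mul_eq_one_right hz0 hzz', Int.cast_one]

/-- Adelic form of `ℚ_{>0} ∩ ẑ^× = {1}`: a positive rational whose principal finite adele is a `ẑ`-unit is `1`.
[cite: Milne2005ShimuraVarieties, §4 Rem. 4.17 (a) with fn. 31 p. 48] -/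
theorem Rat.eq_one_of_pos_of_forall_valued_eq_one {r : ℚ} (hr : 0 < r)
    (h : ∀ v, Valued.v ((algebraMap ℚ finAdeleQ r) v) = 1) : r = 1 :=
  Rat.eq_one_of_pos_of_forall_valuation_eq_one hr fun v => by rw [← valued_algebraMap_finAdeleQ_apply]; exact h v

/-- **Uniqueness of the normalising scalar**: if `r·x` and `r'·x` are both `ẑ`-units for positive rationals `r, r'`
(the existence of such an `r` for every idèle `x` is ★ `Automorphic.Rat.FiniteAdeleRing.exists_pos_valued_algebraMap_mul_eq_one`),
then `r = r'` — so `𝔸_{ℚ,f}^× = ℚ_{>0}^× × ẑ^×` is a DIRECT product. [cite: Milne2005ShimuraVarieties, §4 Rem. 4.17 (a) p. 48 and §5 p. 63]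
[cite: Gelbart1975, (3.3)] -/
theorem Rat.eq_of_forall_valued_mul_eq_one {r r' : ℚ} (hr : 0 < r) (hr' : 0 < r') {x : finAdeleQ}
    (h : ∀ v, Valued.v ((algebraMap ℚ finAdeleQ r * x) v) = 1)
    (h' : ∀ v, Valued.v ((algebraMap ℚ finAdeleQ r' * x) v) = 1) : r = r' := by
  have hq : r' * r⁻¹ = 1 := by
    refine Rat.eq_one_of_pos_of_forall_valuation_eq_one (mul_pos hr' (inv_pos.2 hr)) fun v => ?_
    have h1 := h v
    have h2 := h' v
    rw [Literature.NumberTheory.Automorphic.FiniteAdeleRing.mul_apply', Valuation.map_mul,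
      valued_algebraMap_finAdeleQ_apply] at h1 h2
    rw [map_mul, map_inv₀, eq_inv_of_mul_eq_one_left h1, ← eq_inv_of_mul_eq_one_left h2]
    have h0 : v.valuation ℚ r' ≠ 0 := (Valuation.ne_zero_iff _).2 hr'.ne'
    exact mul_inv_cancel₀ h0
  symm
  calc r' = r' * r⁻¹ * r := by rw [inv_mul_cancel_right₀ hr.ne']
    _ = r := by rw [hq, one_mul]

/-! ### §3. Residues modulo `N`: `ẑ = ℤ + N·ẑ`, well-definedness, and units have residues prime to `N` -/

/-- **`ẑ = ℤ + N·ẑ`**: every `ẑ`-integral finite adele is congruent modulo `N·ẑ` to an integer (`N ≠ 0`; from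
`𝔸_{ℚ,f} = ℚ + N·ẑ` ★ `exists_rat_add_natCast_mul` and `ℚ ∩ ẑ = ℤ`). [cite: CasselsFrohlichANT1967, Ch. II §15] -/
theorem exists_int_sub_intCast_mem_levelIdeal {N : ℕ} (hN : N ≠ 0) {w : finAdeleQ}
    (hw : w ∈ FiniteAdeleRing.integralAdeles (𝓞 ℚ) ℚ) : ∃ a : ℤ, w - (a : finAdeleQ) ∈ levelIdeal N := by
  obtain ⟨k, y, hy, hwky⟩ := exists_rat_add_natCast_mul N hN w
  have hy' : y ∈ FiniteAdeleRing.integralAdeles (𝓞 ℚ) ℚ := (mem_integralAdeles_iff_mem_integralFiniteAdeles y).2 hy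
  have hk : algebraMap ℚ finAdeleQ k ∈ FiniteAdeleRing.integralAdeles (𝓞 ℚ) ℚ := by
    have : algebraMap ℚ finAdeleQ k = w - (N : finAdeleQ) * y := by rw [hwky, add_sub_cancel_right]
    rw [this]
    exact sub_mem hw (Subring.mul_mem _ (natCast_mem _ N) hy')
  obtain ⟨a, ha⟩ := exists_int_cast_eq_of_algebraMap_mem_integralAdeles hk
  refine ⟨a, mem_levelIdeal_iff.2 ⟨y, hy', ?_⟩⟩
  rw [← map_intCast (algebraMap ℚ finAdeleQ) a, ha, hwky, add_sub_cancel_left]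

/-- **Residues are well defined modulo `N`**: two integers congruent to the same finite adele modulo `N·ẑ` are congruent
modulo `N` (`ℤ ∩ N·ẑ = Nℤ`). [cite: CasselsFrohlichANT1967, Ch. II §15] -/
theorem int_dvd_sub_of_sub_intCast_mem_levelIdeal {N : ℕ} (hN : N ≠ 0) {w : finAdeleQ} {a a' : ℤ}
    (ha : w - (a : finAdeleQ) ∈ levelIdeal N) (ha' : w - (a' : finAdeleQ) ∈ levelIdeal N) : (N : ℤ) ∣ a' - a := by
  rw [← intCast_mem_levelIdeal_iff hN]
  have h := sub_mem ha ha'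
  rwa [sub_sub_sub_cancel_left, ← Int.cast_sub] at h

/-- The place of `ℚ` over a rational prime `p`, with `natGenerator = p` (Mathlib `Rat.HeightOneSpectrum.primesEquiv`).
[cite: CasselsFrohlichANT1967, Ch. II §14] -/
theorem Rat.exists_natGenerator_eq {p : ℕ} (hp : p.Prime) :
    ∃ v : HeightOneSpectrum (𝓞 ℚ), Rat.HeightOneSpectrum.natGenerator v = p :=
  ⟨(Rat.HeightOneSpectrum.primesEquiv (R := 𝓞 ℚ)).symm ⟨p, hp⟩, by
    have h := (Rat.HeightOneSpectrum.primesEquiv (R := 𝓞 ℚ)).apply_symm_apply ⟨p, hp⟩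
    exact congrArg Subtype.val h⟩

/-- An integer divisible by `p_v` has `v`-adic valuation `< 1`. [cite: CasselsFrohlichANT1967, Ch. II §14] -/
theorem Rat.valuation_intCast_lt_one_of_dvd (v : HeightOneSpectrum (𝓞 ℚ)) {a : ℤ}
    (h : (Rat.HeightOneSpectrum.natGenerator v : ℤ) ∣ a) : v.valuation ℚ (a : ℚ) < 1 := by
  rw [← map_intCast (algebraMap (𝓞 ℚ) ℚ) a, valuation_lt_one_iff_mem,
    Literature.NumberTheory.Automorphic.Rat.asIdeal_eq_span_natGenerator', Ideal.mem_span_singleton]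
  obtain ⟨b, rfl⟩ := h
  exact ⟨(b : 𝓞 ℚ), by push_cast; ring⟩

/-- An integer NOT divisible by `p_v` has `v`-adic valuation `1`. [cite: CasselsFrohlichANT1967, Ch. II §14] -/
theorem Rat.valuation_intCast_eq_one_of_not_dvd (v : HeightOneSpectrum (𝓞 ℚ)) {a : ℤ}
    (h : ¬ (Rat.HeightOneSpectrum.natGenerator v : ℤ) ∣ a) : v.valuation ℚ (a : ℚ) = 1 := by
  rw [← map_intCast (algebraMap (𝓞 ℚ) ℚ) a, valuation_eq_one_iff_notMem,
    Literature.NumberTheory.Automorphic.Rat.asIdeal_eq_span_natGenerator', Ideal.mem_span_singleton]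
  rintro ⟨b, hb⟩
  apply h
  refine ⟨Rat.ringOfIntegersEquiv b, ?_⟩
  have h1 := congrArg (Rat.ringOfIntegersEquiv : 𝓞 ℚ → ℤ) hb
  rw [map_intCast, map_mul, map_natCast] at h1
  exact h1

/-- `|N|_v < 1` iff `p_v ∣ N` (`N ≠ 0`). [cite: CasselsFrohlichANT1967, Ch. II §14] -/
theorem valued_natCast_finAdeleQ_lt_one_iff {N : ℕ} (v : HeightOneSpectrum (𝓞 ℚ)) :
    Valued.v ((N : finAdeleQ) v) < 1 ↔ Rat.HeightOneSpectrum.natGenerator v ∣ N := by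
  rw [valued_natCast_finAdeleQ_apply]
  constructor
  · intro h
    by_contra hnd
    have h1 := Rat.valuation_intCast_eq_one_of_not_dvd v (a := (N : ℤ)) (by exact_mod_cast hnd)
    rw [Int.cast_natCast] at h1
    exact h.ne h1
  · intro h
    have h1 := Rat.valuation_intCast_lt_one_of_dvd v (a := (N : ℤ)) (by exact_mod_cast h)
    rwa [Int.cast_natCast] at h1

/-- **The residue of a `ẑ`-UNIT is prime to `N`**: if `|w_v|_v = 1` for all `v` and `w ≡ a (mod N·ẑ)`, then
`a` is coprime to `N` (at a prime `p ∣ N`, `|a|_p = |w_p|_p = 1`). [cite: CasselsFrohlichANT1967, Ch. II §16] -/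
theorem isCoprime_of_forall_valued_eq_one_of_sub_intCast_mem_levelIdeal {N : ℕ} (hN : N ≠ 0) {w : finAdeleQ}
    {a : ℤ} (hw : ∀ v, Valued.v (w v) = 1) (ha : w - (a : finAdeleQ) ∈ levelIdeal N) : IsCoprime a (N : ℤ) := by
  rw [Int.isCoprime_iff_gcd_eq_one]
  show Nat.gcd a.natAbs (N : ℤ).natAbs = 1
  rw [Int.natAbs_natCast]
  refine Nat.Coprime.gcd_eq_one (Nat.coprime_of_dvd fun p hp hpa hpN => ?_)
  obtain ⟨v, hv⟩ := Rat.exists_natGenerator_eq hp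
  have hpa' : (Rat.HeightOneSpectrum.natGenerator v : ℤ) ∣ a := by
    rw [hv]; exact Int.ofNat_dvd_left.2 hpa
  have hNv : Valued.v ((N : finAdeleQ) v) < 1 := (valued_natCast_finAdeleQ_lt_one_iff v).2 (hv ▸ hpN)
  have hav : Valued.v ((a : finAdeleQ) v) < 1 := by
    rw [valued_intCast_finAdeleQ_apply]; exact Rat.valuation_intCast_lt_one_of_dvd v hpa'
  have hle := (mem_levelIdeal_iff_forall_valued_le hN _).1 ha v
  rw [Literature.NumberTheory.Automorphic.FiniteAdeleRing.sub_apply'] at hle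
  -- `|w_v - a|_v = |w_v|_v = 1` since `|a|_v < 1 = |w_v|_v`
  have heq : Valued.v (w v - (a : finAdeleQ) v) = Valued.v (w v) :=
    Valuation.map_sub_eq_of_lt_left _ (by rw [hw v]; exact hav)
  rw [heq, hw v] at hle
  exact absurd (lt_of_le_of_lt hle hNv) (lt_irrefl 1)

/-! ### §4. `ẑ`-units: the bridge to integrality, inverses, and SURJECTIVITY `ẑ^× ↠ (ℤ/Nℤ)^×` -/

/-- `|u⁻¹_v|_v · |u_v|_v = 1` for an idèle `u`. [cite: CasselsFrohlichANT1967, Ch. II §16] -/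
theorem valued_inv_mul_valued_eq_one (u : finAdeleQˣ) (v : HeightOneSpectrum (𝓞 ℚ)) :
    Valued.v (((u⁻¹ : finAdeleQˣ) : finAdeleQ) v) * Valued.v ((u : finAdeleQ) v) = 1 := by
  rw [← Valuation.map_mul, ← Literature.NumberTheory.Automorphic.FiniteAdeleRing.mul_apply', Units.inv_mul,
    show (1 : finAdeleQ) v = 1 from rfl, Valuation.map_one]

/-- **Bridge**: an idèle `u` is a `ẑ`-unit in the valuation sense (`|u_v|_v = 1` for all `v`) iff `u` and `u⁻¹` are
`ẑ`-integral (the spelling of ★ `principalLevelSubgroup` / `IsCongOne`). [cite: CasselsFrohlichANT1967, Ch. II §16] -/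
theorem forall_valued_eq_one_iff_mem_integralAdeles (u : finAdeleQˣ) :
    (∀ v, Valued.v ((u : finAdeleQ) v) = 1) ↔
      (u : finAdeleQ) ∈ FiniteAdeleRing.integralAdeles (𝓞 ℚ) ℚ ∧
        ((u⁻¹ : finAdeleQˣ) : finAdeleQ) ∈ FiniteAdeleRing.integralAdeles (𝓞 ℚ) ℚ := by
  rw [mem_integralAdeles_iff_forall_valued_le_one, mem_integralAdeles_iff_forall_valued_le_one]
  constructor
  · intro h
    refine ⟨fun v => (h v).le, fun v => ?_⟩
    have h1 := valued_inv_mul_valued_eq_one u v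
    rw [h v, mul_one] at h1
    exact h1.le
  · rintro ⟨h, h'⟩ v
    refine le_antisymm (h v) ?_
    have h1 := valued_inv_mul_valued_eq_one u v
    calc (1 : WithZero (Multiplicative ℤ))
        = Valued.v (((u⁻¹ : finAdeleQˣ) : finAdeleQ) v) * Valued.v ((u : finAdeleQ) v) := h1.symm
      _ ≤ 1 * Valued.v ((u : finAdeleQ) v) := mul_le_mul' (h' v) le_rfl
      _ = Valued.v ((u : finAdeleQ) v) := one_mul _

/-- The inverse of a `ẑ`-unit is a `ẑ`-unit. [cite: CasselsFrohlichANT1967, Ch. II §16] -/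
theorem forall_valued_inv_eq_one {u : finAdeleQˣ} (hu : ∀ v, Valued.v ((u : finAdeleQ) v) = 1) (v) :
    Valued.v (((u⁻¹ : finAdeleQˣ) : finAdeleQ) v) = 1 := by
  have h1 := valued_inv_mul_valued_eq_one u v
  rwa [hu v, mul_one] at h1

/-- `U_N` is a group: if a `ẑ`-unit `u` is `≡ 1 (mod N·ẑ)` then so is `u⁻¹` (`u⁻¹ - 1 = u⁻¹·(1 - u)`).
[cite: CasselsFrohlichANT1967, Ch. II §16] -/
theorem inv_sub_one_mem_levelIdeal {N : ℕ} {u : finAdeleQˣ} (hu : ∀ v, Valued.v ((u : finAdeleQ) v) = 1)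
    (h : (u : finAdeleQ) - 1 ∈ levelIdeal N) : ((u⁻¹ : finAdeleQˣ) : finAdeleQ) - 1 ∈ levelIdeal N := by
  have heq : ((u⁻¹ : finAdeleQˣ) : finAdeleQ) - 1 = ((u⁻¹ : finAdeleQˣ) : finAdeleQ) * (-((u : finAdeleQ) - 1)) := by
    rw [neg_sub, mul_sub, mul_one, Units.inv_mul]
  rw [heq]
  exact Literature.AlgebraicGeometry.ModuliOfAbelianVarieties.mul_mem_levelIdeal_of_mem_integralAdeles
    (mem_integralAdeles_of_forall_valued_eq_one (forall_valued_inv_eq_one hu)) (neg_mem h)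

/-- Products of `ẑ`-units are `ẑ`-units. [cite: CasselsFrohlichANT1967, Ch. II §16] -/
theorem forall_valued_mul_eq_one {x y : finAdeleQ} (hx : ∀ v, Valued.v (x v) = 1) (hy : ∀ v, Valued.v (y v) = 1)
    (v) : Valued.v ((x * y) v) = 1 := by
  rw [Literature.NumberTheory.Automorphic.FiniteAdeleRing.mul_apply', Valuation.map_mul, hx v, hy v, mul_one]

/-- A prime dividing `N` does not divide an integer coprime to `N`. [cite: CasselsFrohlichANT1967, Ch. II §15] -/
theorem not_intCast_dvd_of_isCoprime_of_dvd {N : ℕ} {a : ℤ} (ha : IsCoprime a (N : ℤ)) {p : ℕ} (hp : p.Prime)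
    (hpN : p ∣ N) : ¬ (p : ℤ) ∣ a := by
  intro hpa
  have hu : IsUnit (p : ℤ) := ha.isUnit_of_dvd' hpa (by exact_mod_cast hpN)
  rw [Int.isUnit_iff, ← Int.natCast_one] at hu
  rcases hu with h | h
  · exact hp.one_lt.ne' (by exact_mod_cast h)
  · have : (0 : ℤ) ≤ (p : ℤ) := Int.natCast_nonneg p
    omega

/-- **SURJECTIVITY `ẑ^× ↠ (ℤ/Nℤ)^×`**: every integer `a` prime to `N` (`N ≠ 0`) is the residue modulo `N·ẑ` of a
`ẑ`-unit — the idèle equal to `a` at the primes dividing `N` and to `1` elsewhere.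
[cite: Milne2005ShimuraVarieties, §5 (5.2) and Lemma 5.13] [cite: CasselsFrohlichANT1967, Ch. II §16] -/
theorem exists_units_forall_valued_eq_one_sub_intCast_mem_levelIdeal {N : ℕ} (hN : N ≠ 0) {a : ℤ}
    (ha : IsCoprime a (N : ℤ)) :
    ∃ u : finAdeleQˣ, (∀ v, Valued.v ((u : finAdeleQ) v) = 1) ∧ (u : finAdeleQ) - (a : finAdeleQ) ∈ levelIdeal N := by
  classical
  -- at a place where `|N|_v ≠ 1`, i.e. `p_v ∣ N`, the integer `a` is a `v`-adic unit
  have hav : ∀ v, Valued.v ((N : finAdeleQ) v) ≠ 1 → Valued.v ((a : finAdeleQ) v) = 1 := by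
    intro v hv
    have hlt : Valued.v ((N : finAdeleQ) v) < 1 := lt_of_le_of_ne (valued_natCast_finAdeleQ_le_one N v) hv
    have hpN := (valued_natCast_finAdeleQ_lt_one_iff v).1 hlt
    rw [valued_intCast_finAdeleQ_apply]
    exact Rat.valuation_intCast_eq_one_of_not_dvd v
      (not_intCast_dvd_of_isCoprime_of_dvd ha (Rat.HeightOneSpectrum.prime_natGenerator v) hpN)
  -- the idèle: `a` where `p_v ∣ N`, `1` elsewhere
  let f : ∀ v : HeightOneSpectrum (𝓞 ℚ), v.adicCompletion ℚ := fun v =>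
    if Valued.v ((N : finAdeleQ) v) = 1 then 1 else (a : finAdeleQ) v
  have hf : ∀ v, Valued.v (f v) = 1 := by
    intro v
    by_cases hv : Valued.v ((N : finAdeleQ) v) = 1
    · simp only [f, if_pos hv, Valuation.map_one]
    · simp only [f, if_neg hv]
      exact hav v hv
  let u₀ : finAdeleQ := ⟨f, Filter.Eventually.of_forall fun v =>
    (HeightOneSpectrum.mem_adicCompletionIntegers _ _ _).2 (hf v).le⟩
  have hu₀v : ∀ v, u₀ v = f v := fun v => rfl
  have hu₀ : IsUnit u₀ := by
    refine FiniteAdeleRing.isUnit_iff.2 ⟨fun v => ?_, Filter.Eventually.of_forall fun v => ?_⟩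
    · rw [hu₀v, ← (Valued.v : Valuation (v.adicCompletion ℚ) _).ne_zero_iff, hf v]
      exact one_ne_zero
    · rw [hu₀v]; exact hf v
  refine ⟨hu₀.unit, fun v => by rw [hu₀.unit_spec, hu₀v]; exact hf v, ?_⟩
  rw [hu₀.unit_spec, mem_levelIdeal_iff_forall_valued_le hN]
  intro v
  rw [Literature.NumberTheory.Automorphic.FiniteAdeleRing.sub_apply', hu₀v]
  by_cases hv : Valued.v ((N : finAdeleQ) v) = 1
  · simp only [f, if_pos hv]
    rw [hv]
    refine (Valuation.map_sub _ _ _).trans (max_le ?_ (valued_intCast_finAdeleQ_le_one a v))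
    rw [Valuation.map_one]
  · simp only [f, if_neg hv, sub_self, Valuation.map_zero]
    exact zero_le

/-! ### §5. The class criterion: `ℚ_{>0}^× \ 𝔸_{ℚ,f}^× / U_N ≅ (ℤ/Nℤ)^×` without a quotient type -/

/-- **Every idèle has an invariant**: for `x ∈ 𝔸_{ℚ,f}^×` and `N ≠ 0` there are a positive rational `r` (unique by
`Rat.eq_of_forall_valued_mul_eq_one`) with `r·x ∈ ẑ^×` and an integer `a` prime to `N` (unique modulo `N` by
`int_dvd_sub_of_sub_intCast_mem_levelIdeal`) with `r·x ≡ a (mod N·ẑ)`. [cite: Milne2005ShimuraVarieties, §5 (5.2), Lemma 5.13]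
[cite: Gelbart1975, (3.3)] -/
theorem exists_pos_rat_int_forall_valued_mul_eq_one_sub_intCast_mem_levelIdeal {N : ℕ} (hN : N ≠ 0)
    (x : finAdeleQˣ) :
    ∃ (r : ℚ) (a : ℤ), 0 < r ∧ IsCoprime a (N : ℤ) ∧ (∀ v, Valued.v ((algebraMap ℚ finAdeleQ r * x) v) = 1) ∧
      algebraMap ℚ finAdeleQ r * x - (a : finAdeleQ) ∈ levelIdeal N := by
  obtain ⟨r, hr, hw⟩ := Literature.NumberTheory.Automorphic.Rat.FiniteAdeleRing.exists_pos_valued_algebraMap_mul_eq_one x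
  obtain ⟨a, ha⟩ := exists_int_sub_intCast_mem_levelIdeal hN (mem_integralAdeles_of_forall_valued_eq_one hw)
  exact ⟨r, a, hr, isCoprime_of_forall_valued_eq_one_of_sub_intCast_mem_levelIdeal hN hw ha, hw, ha⟩

/-- **The invariant is a class function** (injectivity of `(ℤ/Nℤ)^× ← classes`): if `x' = q·x·u` with `q ∈ ℚ_{>0}` and
`u ∈ U_N` (a `ẑ`-unit `≡ 1 (mod N·ẑ)`), then the residues `a, a'` of the normalisations `r·x, r'·x' ∈ ẑ^×` agree
modulo `N`. [cite: Milne2005ShimuraVarieties, §5 Lemma 5.13 and Thm. 5.17] -/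
theorem int_dvd_sub_of_eq_mul_mul {N : ℕ} (hN : N ≠ 0) {x x' u : finAdeleQˣ} {r r' q : ℚ} {a a' : ℤ}
    (hr : 0 < r) (hw : ∀ v, Valued.v ((algebraMap ℚ finAdeleQ r * x) v) = 1)
    (ha : algebraMap ℚ finAdeleQ r * x - (a : finAdeleQ) ∈ levelIdeal N)
    (hr' : 0 < r') (hw' : ∀ v, Valued.v ((algebraMap ℚ finAdeleQ r' * x') v) = 1)
    (ha' : algebraMap ℚ finAdeleQ r' * x' - (a' : finAdeleQ) ∈ levelIdeal N)
    (hq : 0 < q) (hu : ∀ v, Valued.v ((u : finAdeleQ) v) = 1) (hu1 : (u : finAdeleQ) - 1 ∈ levelIdeal N)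
    (hxx' : (x' : finAdeleQ) = algebraMap ℚ finAdeleQ q * x * u) : (N : ℤ) ∣ a' - a := by
  -- both `r` and `r'·q` normalise the idèle `x·u`
  have h1 : ∀ v, Valued.v ((algebraMap ℚ finAdeleQ r * ((x : finAdeleQ) * u)) v) = 1 := fun v => by
    rw [← mul_assoc]; exact forall_valued_mul_eq_one hw hu v
  have h2 : ∀ v, Valued.v ((algebraMap ℚ finAdeleQ (r' * q) * ((x : finAdeleQ) * u)) v) = 1 := fun v => by
    have : algebraMap ℚ finAdeleQ (r' * q) * ((x : finAdeleQ) * u) = algebraMap ℚ finAdeleQ r' * x' := by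
      rw [hxx', map_mul]; ring
    rw [this]; exact hw' v
  have hrq : r = r' * q := Rat.eq_of_forall_valued_mul_eq_one hr (mul_pos hr' hq) h1 h2
  -- hence `r'·x' = (r·x)·u ≡ a·1 (mod N·ẑ)`
  have hkey : algebraMap ℚ finAdeleQ r' * x' = algebraMap ℚ finAdeleQ r * x * u := by
    rw [hxx', hrq, map_mul]; ring
  have hmem : algebraMap ℚ finAdeleQ r' * x' - (a : finAdeleQ) ∈ levelIdeal N := by
    have heq : algebraMap ℚ finAdeleQ r' * x' - (a : finAdeleQ) =
        (u : finAdeleQ) * (algebraMap ℚ finAdeleQ r * x - a) + (a : finAdeleQ) * ((u : finAdeleQ) - 1) := by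
      rw [hkey]; ring
    rw [heq]
    exact add_mem
      (Literature.AlgebraicGeometry.ModuliOfAbelianVarieties.mul_mem_levelIdeal_of_mem_integralAdeles
        (mem_integralAdeles_of_forall_valued_eq_one hu) ha)
      (Literature.AlgebraicGeometry.ModuliOfAbelianVarieties.mul_mem_levelIdeal_of_mem_integralAdeles
        (intCast_mem_integralAdeles a) hu1)
  exact int_dvd_sub_of_sub_intCast_mem_levelIdeal hN hmem ha'

/-- **Equal invariants ⇒ same class** (surjectivity onto classes / well-definedness of the inverse map): if the residues
of the normalisations of `x, x'` agree modulo `N`, then `x' = q·x·u` with `q ∈ ℚ_{>0}` and `u ∈ U_N` (a `ẑ`-unit with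
`u ≡ 1`, `u⁻¹ ≡ 1 (mod N·ẑ)`); explicitly `q = r/r'`, `u = (r'·x')·(r·x)⁻¹`.
[cite: Milne2005ShimuraVarieties, §5 Lemma 5.13 and Thm. 5.17] -/
theorem exists_eq_mul_mul_of_int_dvd_sub {N : ℕ} (hN : N ≠ 0) {x x' : finAdeleQˣ} {r r' : ℚ} {a a' : ℤ}
    (hr : 0 < r) (hw : ∀ v, Valued.v ((algebraMap ℚ finAdeleQ r * x) v) = 1)
    (ha : algebraMap ℚ finAdeleQ r * x - (a : finAdeleQ) ∈ levelIdeal N)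
    (hr' : 0 < r') (hw' : ∀ v, Valued.v ((algebraMap ℚ finAdeleQ r' * x') v) = 1)
    (ha' : algebraMap ℚ finAdeleQ r' * x' - (a' : finAdeleQ) ∈ levelIdeal N) (hdvd : (N : ℤ) ∣ a' - a) :
    ∃ (q : ℚ) (u : finAdeleQˣ), 0 < q ∧ (∀ v, Valued.v ((u : finAdeleQ) v) = 1) ∧
      (u : finAdeleQ) - 1 ∈ levelIdeal N ∧ ((u⁻¹ : finAdeleQˣ) : finAdeleQ) - 1 ∈ levelIdeal N ∧
      (x' : finAdeleQ) = algebraMap ℚ finAdeleQ q * x * u := by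
  -- the units `w = r·x`, `w' = r'·x'`
  set cr : finAdeleQˣ := Units.map (algebraMap ℚ finAdeleQ).toMonoidHom (Units.mk0 r hr.ne') with hcr
  set cr' : finAdeleQˣ := Units.map (algebraMap ℚ finAdeleQ).toMonoidHom (Units.mk0 r' hr'.ne') with hcr'
  have hwval : ((cr * x : finAdeleQˣ) : finAdeleQ) = algebraMap ℚ finAdeleQ r * x := rfl
  have hw'val : ((cr' * x' : finAdeleQˣ) : finAdeleQ) = algebraMap ℚ finAdeleQ r' * x' := rfl
  set u : finAdeleQˣ := cr' * x' * (cr * x)⁻¹ with hu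
  have huval : (u : finAdeleQ) = algebraMap ℚ finAdeleQ r' * x' * (((cr * x)⁻¹ : finAdeleQˣ) : finAdeleQ) := rfl
  have hinv1 : algebraMap ℚ finAdeleQ r * x * (((cr * x)⁻¹ : finAdeleQˣ) : finAdeleQ) = 1 := by
    rw [← hwval, Units.mul_inv]
  have hwu : ∀ v, Valued.v (((cr * x : finAdeleQˣ) : finAdeleQ) v) = 1 := fun v => by rw [hwval]; exact hw v
  have huv : ∀ v, Valued.v ((u : finAdeleQ) v) = 1 := fun v => by
    rw [huval]
    exact forall_valued_mul_eq_one hw' (forall_valued_inv_eq_one hwu) v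
  -- `w' - w ∈ N·ẑ`
  have hdiff : algebraMap ℚ finAdeleQ r' * x' - algebraMap ℚ finAdeleQ r * x ∈ levelIdeal N := by
    have heq : algebraMap ℚ finAdeleQ r' * x' - algebraMap ℚ finAdeleQ r * x =
        (algebraMap ℚ finAdeleQ r' * x' - a') + ((a' - a : ℤ) : finAdeleQ) - (algebraMap ℚ finAdeleQ r * x - a) := by
      push_cast; ring
    rw [heq]
    exact sub_mem (add_mem ha' ((intCast_mem_levelIdeal_iff hN _).2 hdvd)) ha
  have hu1 : (u : finAdeleQ) - 1 ∈ levelIdeal N := by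
    have heq : (u : finAdeleQ) - 1 =
        (((cr * x)⁻¹ : finAdeleQˣ) : finAdeleQ) * (algebraMap ℚ finAdeleQ r' * x' - algebraMap ℚ finAdeleQ r * x) := by
      rw [huval, mul_sub, ← hinv1]; ring
    rw [heq]
    exact Literature.AlgebraicGeometry.ModuliOfAbelianVarieties.mul_mem_levelIdeal_of_mem_integralAdeles
      (mem_integralAdeles_of_forall_valued_eq_one (forall_valued_inv_eq_one hwu)) hdiff
  refine ⟨r / r', u, div_pos hr hr', huv, hu1, inv_sub_one_mem_levelIdeal huv hu1, ?_⟩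
  -- `x' = (r/r')·x·u`
  have hrr' : r / r' * r' * r⁻¹ = 1 := by field_simp
  have hxw : (x : finAdeleQ) * (((cr * x)⁻¹ : finAdeleQˣ) : finAdeleQ) = algebraMap ℚ finAdeleQ r⁻¹ := by
    calc (x : finAdeleQ) * (((cr * x)⁻¹ : finAdeleQˣ) : finAdeleQ)
        = algebraMap ℚ finAdeleQ r⁻¹ *
            (algebraMap ℚ finAdeleQ r * x * (((cr * x)⁻¹ : finAdeleQˣ) : finAdeleQ)) := by
          rw [← mul_assoc, ← mul_assoc, ← map_mul, inv_mul_cancel₀ hr.ne', map_one, one_mul]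
      _ = algebraMap ℚ finAdeleQ r⁻¹ := by rw [hinv1, mul_one]
  symm
  calc algebraMap ℚ finAdeleQ (r / r') * x * u
      = algebraMap ℚ finAdeleQ (r / r') * algebraMap ℚ finAdeleQ r' * x' *
          ((x : finAdeleQ) * (((cr * x)⁻¹ : finAdeleQˣ) : finAdeleQ)) := by rw [huval]; ring
    _ = algebraMap ℚ finAdeleQ (r / r' * r' * r⁻¹) * x' := by rw [hxw, map_mul, map_mul]; ring
    _ = x' := by rw [hrr', map_one, one_mul]

/-- **Every class prime to `N` occurs** (surjectivity of `classes → (ℤ/Nℤ)^×`): for `a` coprime to `N` there is an idèle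
whose invariant (with normalising scalar `r = 1`) is `a` — the `ẑ`-unit of
`exists_units_forall_valued_eq_one_sub_intCast_mem_levelIdeal`. [cite: Milne2005ShimuraVarieties, §5 Lemma 5.13 and Thm. 5.17] -/
theorem exists_units_forall_valued_one_mul_eq_one_sub_intCast_mem_levelIdeal {N : ℕ} (hN : N ≠ 0) {a : ℤ}
    (ha : IsCoprime a (N : ℤ)) :
    ∃ x : finAdeleQˣ, (∀ v, Valued.v ((algebraMap ℚ finAdeleQ 1 * x) v) = 1) ∧
      algebraMap ℚ finAdeleQ 1 * x - (a : finAdeleQ) ∈ levelIdeal N := by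
  obtain ⟨u, hu, hua⟩ := exists_units_forall_valued_eq_one_sub_intCast_mem_levelIdeal hN ha
  exact ⟨u, by rw [map_one, one_mul]; exact hu, by rw [map_one, one_mul]; exact hua⟩

end Literature.NumberTheory.Adeles

end
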